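import Mathlib
import Literature.MathematicalPhysics.QuantumFieldTheory.Balaban1983to89.B6Ineq268

/-!
# `Balaban1983to89.B6Ineq283` — the display (2.83), p. 237: the single-scale sum over supp h_{□′} (member 2 ⇒ 3)
holds with an M-uniform O(1) if and only if δ₁ < ¼δ₀ (sufficiency from (2.54) + (2.61) at the leftover rate;
necessity by a «face» witness), the cube gap and the level separation (2.60) give member 4, and the scale weight
L^{4(j−j′)} of member 4 is absorbed uniformly in the number of scales if and only if L⁴ ≤ e^{⅛δ₀RM}, i.e.
32 log L ≤ δ₀RM (necessity by the chain witness of `…B6Ineq268`) (B6 = T. Bałaban, *Propagators and renormalization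
transformations for lattice gauge theories. II*, Commun. Math. Phys. **96**, 223–250 (1984) [Balaban1984PropagatorsII])

CITATION HEADER (lean-in-tree rule 2026-08-18).  Cell `pub-balaban`, unit `b2b-balaban-b06-g5` (paper sub-cell B06,
gen 5 — the owner lineage of `…B6`, `…B6RandomWalk`, `…B6KernelComposition`, `…B6WeightedEncoding`, `…B6Ineq268`).
Source: doi:10.1007/bf01240221, held `paper:balaban1984-cmp96-propagators-rt-ii`; journal page = PDF page + 222; the
quotations below were read from the page renders `b2b-balaban-ref1/pages/1984-cmp96-propagators-rt-II/
1984-cmp96-propagators-rt-II-p012-x2.png` (p. 234), `…-p015-x2.png` (p. 237) and `…-p016-x2.png` (p. 238) AS IMAGES.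
Kernel twin of the hand certification GAPS C-adv4-40 (unit b2b-balaban-adv4-g14, hostile second reading of
(2.82)–(2.87)) and of its located conventions «δ₁ < ¼δ₀» and «e^{⅛δ₀RM} ≥ L⁴»; cell rows GAPS C-b06g5-4, DIVERGENCE
D-b06.17; journal claim C-adv4-40-KERNEL.

THE PRINTED TEXT.  p. 237 [PDF 15], verbatim: *"|C_□(y, y′)| ≤ O(1)(L^jη)^{−d−4} e^{−δ₁(L^jη)^{−1}|y−y′|}, y, y′ ∈ 𝔅∩□. (2.81)
Now we will proceed in the same way as in Sect. 5, (5.12)–(5.17) [3]. We will show that Q′G′²Q′*C is a good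
approximation of identity."* … *"with an obvious definition of the operators R_{□,□′}. We have to estimate the norm of
R in the space L²(𝔅). For example let us consider the operator R_{□,□′}C_{□′}h_{□′} with □ ≠ □′. A kernel of this
operator can be estimated as follows
|(□′ − 1)(y) h²_□(y) Σ_{y″∈supp h_{□′}} (L^{j′}η)^d (Q′G′²Q′*)(y, y″) h_{□′}(y″) C_{□′}(y″, y′) h_{□′}(y′)|
≤ O(1)(L^jη)⁴ Σ_{y″∈supp h_{□′}} e^{−½δ₀d(y,y″)} c₁ (L^{j′}η)^{−d−4} e^{−δ₁(L^{j′}η)^{−1}|y″−y′|}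
≤ O(1)(L^jη)⁴(L^{j′}η)^{−4} e^{−¼δ₀d(y, supp h_{□′}) − δ₁d(y,y′)} (L^{j′}η)^{−d}
= O(1) e^{−⅛δ₀M} L^{4(j−j′)} e^{−⅛δ₀RM max{|j−j′|−1,0}} e^{−δ₁d(y,y′)} (L^{j′}η)^{−d}
≤ O(1) e^{−⅛δ₀M} e^{−δ₁d(y,y′)} (L^{j′}η)^{−d}, (2.83)
where we have used the fact that y ∉ □̃′, and all the properties of the distance d(·, ·). From this inequality it
follows that |R_{□,□′}C_{□′}h_{□′}λ| ≤ O(1) e^{−⅛δ₀M} e^{−½δ₁d(□,□′)} |λ|, (2.84)"*; p. 238 [PDF 16]: *"so for M large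
enough the norm is small."*  Lemma 2.1, p. 234 [PDF 12], verbatim: *"e^{−αδ₀d(y,y′)} ≤ e^{−αδ₀RM max{|j−j′|−1,0}},
y ∈ Λ_j, y′ ∈ Λ_{j′}, (2.60) sup_{y∈𝔅} Σ_{y′∈𝔅} e^{−αδ₀d(y,y′)} ≤ c₁(α), (2.61)"* (tree: `B6RandomWalk.Ineq260/Ineq261`,
generic-constant form `B6Lemma21Repaired.Ineq261With`, metric form `B6Ineq268.LevelSep`; the triangle inequality
(2.54), p. 233, = `B6RandomWalk.Triangle254`).

THE TYPING (members 2–5 of (2.83) with the common prefactor O(1)·c₁·(L^{j′}η)^{−d} taken out; y ∈ Λ_j, y′ ∈ Λ_{j′};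
S′ = supp h_{□′} ⊂ 𝔅 a finite set of sites; ρ(y″) stands for the printed (L^{j′}η)^{−1}|y″ − y′|, entering only
through the hypothesis d(y″, y′) ≤ ρ(y″) for y″ ∈ S′ («all the properties of the distance d(·, ·)»: the straight
contour inside the cube □′, whose portions lie at scales ≥ j′, is admissible in (2.46)); D stands for
d(y, supp h_{□′}) = min_{y″∈S′} d(y, y″), entering through D ≤ d(y, y″) (y″ ∈ S′) and, for member 4, through the two
printed uses «y ∉ □̃′» (D ≥ M, typed with a free gap `Mg` — the print's M; GAPS G-adv4-14 locates the actual gap of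
the (1.118)-[B5] partition at M/3) and (2.60) (D ≥ RM·max{|j−j′|−1,0}, `levelTerm_le` from `LevelSep`);
(L^jη)⁴(L^{j′}η)^{−4} = (L^{2(j−j′)})² = `ratio4` (`ratio4_eq_len`)):
`line283_2` = (L^jη)⁴(L^{j′}η)^{−4} Σ_{y″∈S′} e^{−½δ₀d(y,y″)} e^{−δ₁ρ(y″)},
`line283_3` = (L^jη)⁴(L^{j′}η)^{−4} e^{−¼δ₀D} e^{−δ₁d(y,y′)},
`line283_4` = e^{−⅛δ₀Mg} L^{4(j−j′)} e^{−⅛δ₀RM max{|j−j′|−1,0}} e^{−δ₁d(y,y′)},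
`line283_5` = L⁴ e^{−⅛δ₀Mg} e^{−δ₁d(y,y′)} (the print's O(1) of member 5 absorbs the L⁴).

WHAT THIS MODULE PROVES (kernel-checked; no `sorry`, no axiom beyond Lean's three; every hypothesis is a tree
predicate of Lemma 2.1 / (2.54) or an explicit numerical relation):
1. `line2_le_line3` — member 2 ≤ c · member 3 for EVERY split δ₁ + σδ₀ ≤ ¼δ₀ of the surplus rate ¼δ₀ of d(y, y″)
   (½ = ¼ kept for d(y, supp h_{□′}) + δ₁ moved onto d(y, y′) by (2.54) + σ summed by (2.61) at α = σ with constant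
   c), over any geometry with (2.54) and non-negative distance.  With the printed M-independent c₁(σ) this is
   available exactly when σ > 0, i.e. δ₁ < ¼δ₀ — the convention located in GAPS C-adv4-40 («δ₁ := min(δ₁ of (2.79),
   ⅛δ₀)»; «a decay rate may always be decreased»).
2. `line3_not_uniform_above_quarter`, `line3_not_uniform_at_quarter` — THE RATE CONDITION IS SHARP for an O(1)
   uniform in the geometry: on the «face» witnesses `faceGeo m D` (m + 1 support points p₀, …, p_m pairwise at
   distances |t − s|, all at distance D from y and m from y′, d(y, y′) = D + m; an isometric copy of a configuration in
   (ℝ², ℓ^∞), so (2.54) and symmetry are inherited, one scale, and (2.61) holds at every rate α with the m- and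
   D-independent constant 2 + c₀(α), `faceGeo_ineq261With`) member 2 / member 3 = (m + 1)·e^{(δ₁−¼δ₀)D}: for
   δ₁ > ¼δ₀ no constant works even with a one-point support (m = 0, D → ∞), and at δ₁ = ¼δ₀ the best constant is
   ≥ m + 1 = |supp h_{□′} ∩ face|, i.e. grows with M.  (Remark, not typed: a polynomially M-dependent O(1) would still
   be beaten by e^{−⅛δ₀M} in (2.84)–(2.85), so the convention δ₁ < ¼δ₀ is about the printed M-uniform O(1), not about
   Prop. 2.3.)
3. `line3_le_line4` — member 3 ≤ member 4 from the gap Mg ≤ D and the level term RM·max{|j−j′|−1,0} ≤ D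
   (`levelTerm_le`: from `LevelSep` and one support point at the scale of y′ realising D); the printed «=» is a «≤».
4. `line4_le_line5` — member 4 ≤ member 5 with the k-UNIFORM constant L⁴ as soon as L⁴ ≤ e^{⅛δ₀RM}
   (⇔ 32 log L ≤ δ₀RM; `ratio4_mul_exp_le`, the square of `B6Ineq268.ratio_mul_exp_le`), and `line2_le_line5` —
   the whole chain member 2 ≤ c · member 5 under the hypotheses of 1, 3, 4.
5. `line4_not_uniform` — THE THRESHOLD IS SHARP: if e^{⅛δ₀RM} < L⁴ then for every C the chain witness of
   `…B6Ineq268` (one site per level, consecutive levels exactly RM apart; (2.54), symmetry, (2.60), (2.61) with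
   k-independent constants) has a depth N and a pair y ∈ Λ_N, y′ ∈ Λ_0 with member 4 > C · member 5.
WHAT IT DOES NOT PROVE: member 1 ⇒ member 2 (the kernel bounds (2.68) — used here at the rate ½δ₀ where (2.68) prints
¼δ₀, covered by the «choice of factors» remark p. 235, cf. C-adv4-40 — and (2.81), |h_{□′}| ≤ 1, and the cancellation
(L^{j′}η)^d(L^{j″}η)^{−d} = 1 on supp h_{□′}); the admissibility of the straight contour (hypothesis `hρ`); the size of
the gap («y ∉ □̃′», hypothesis `hgap`; G-adv4-14); (2.84)–(2.87) (the ℓ^∞/ℓ²(𝔅) norm bounds and the Neumann series,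
C-adv4-40, `…B6Cor28`, `…QGQInverse`).  Relation to `…B6Ineq268`: that module treats the sum over ALL scales y″ ∈ 𝔅 of
(2.68) (weight L^{2(j″−j)} inside the sum, threshold 8 log L ≤ δ₀RM); here the sum runs over ONE cube at the scale of
y′ and the scale weight L^{4(j−j′)} sits outside it (threshold 32 log L ≤ δ₀RM) — the two located «R big compared with
log L» conditions of Sect. B (C-B6-3, G-pv01-4 (ii), C-adv4-40) are now both theorems with their exact constants.
Value = kernel certificate of bookkeeping with its exact thresholds, NOT summit progress.
-/

namespace Literature.MathematicalPhysics.QuantumFieldTheory.Balaban1983to89.B6Ineq283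

open Literature.MathematicalPhysics.QuantumFieldTheory.Balaban1983to89
open Literature.MathematicalPhysics.QuantumFieldTheory.Balaban1983to89.B6Ineq268
open Finset

/-! ## §1. Carriers: the scale weight (L^jη)⁴(L^{j′}η)^{−4} and members 2–5 of (2.83) -/

section Carriers

variable (g : B6.Geometry)

/-- The scale weight (L^jη)⁴(L^{j′}η)^{−4} = L^{4(j−j′)} of (2.83) members 2–4 (y ∈ Λ_j, y′ ∈ Λ_{j′}), typed as the
square of `B6Ineq268.ratio g y′ y` = L^{2j}/L^{2j′} (natural-number exponents; `ratio4_eq_len` identifies it with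
(L^jη)⁴/(L^{j′}η)⁴). [cite: Balaban1984PropagatorsII, (2.83) p.237] -/
noncomputable def ratio4 (y y' : g.Site) : ℝ := ratio g y' y ^ 2

/-- (2.83) MEMBER 2 with the prefactor O(1)·c₁·(L^{j′}η)^{−d} taken out:
(L^jη)⁴(L^{j′}η)^{−4} Σ_{y″∈supp h_{□′}} e^{−½δ₀d(y,y″)} e^{−δ₁ρ(y″)}, printed
*"O(1)(L^jη)⁴ Σ_{y″∈supp h_{□′}} e^{−½δ₀d(y,y″)} c₁ (L^{j′}η)^{−d−4} e^{−δ₁(L^{j′}η)^{−1}|y″−y′|}"* (S′ = supp h_{□′},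
ρ(y″) = (L^{j′}η)^{−1}|y″−y′|). [cite: Balaban1984PropagatorsII, (2.83) member 2 p.237] -/
noncomputable def line283_2 (δ₀ δ₁ : ℝ) (S' : Finset g.Site) (ρ : g.Site → ℝ) (y y' : g.Site) : ℝ :=
  ratio4 g y y' * ∑ y'' ∈ S', Real.exp (-(1 / 2 * δ₀ * g.dist y y'')) * Real.exp (-(δ₁ * ρ y''))

/-- (2.83) MEMBER 3 (prefactor taken out): (L^jη)⁴(L^{j′}η)^{−4} e^{−¼δ₀D} e^{−δ₁d(y,y′)}, printed
*"O(1)(L^jη)⁴(L^{j′}η)^{−4} e^{−¼δ₀d(y, supp h_{□′}) − δ₁d(y,y′)} (L^{j′}η)^{−d}"* (D = d(y, supp h_{□′})).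
[cite: Balaban1984PropagatorsII, (2.83) member 3 p.237] -/
noncomputable def line283_3 (δ₀ δ₁ D : ℝ) (y y' : g.Site) : ℝ :=
  ratio4 g y y' * Real.exp (-(1 / 4 * δ₀ * D)) * Real.exp (-(δ₁ * g.dist y y'))

/-- (2.83) MEMBER 4 (prefactor taken out): e^{−⅛δ₀Mg} L^{4(j−j′)} e^{−⅛δ₀RM max{|j−j′|−1,0}} e^{−δ₁d(y,y′)}, printed
*"O(1) e^{−⅛δ₀M} L^{4(j−j′)} e^{−⅛δ₀RM max{|j−j′|−1,0}} e^{−δ₁d(y,y′)} (L^{j′}η)^{−d}"* (Mg = the gap between y ∉ □̃′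
and supp h_{□′} in the units of d; printed M). [cite: Balaban1984PropagatorsII, (2.83) member 4 p.237] -/
noncomputable def line283_4 (δ₀ δ₁ Mg : ℝ) (y y' : g.Site) : ℝ :=
  Real.exp (-(1 / 8 * δ₀ * Mg)) * ratio4 g y y' * Real.exp (-(1 / 8 * δ₀ * g.R * g.M * mx g y y')) *
    Real.exp (-(δ₁ * g.dist y y'))

/-- (2.83) MEMBER 5 (prefactor taken out, the absorbed weight L⁴ made explicit): L⁴ e^{−⅛δ₀Mg} e^{−δ₁d(y,y′)}, printed
*"O(1) e^{−⅛δ₀M} e^{−δ₁d(y,y′)} (L^{j′}η)^{−d}"*. [cite: Balaban1984PropagatorsII, (2.83) member 5 p.237] -/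
noncomputable def line283_5 (δ₀ δ₁ Mg : ℝ) (y y' : g.Site) : ℝ :=
  g.L ^ 4 * Real.exp (-(1 / 8 * δ₀ * Mg)) * Real.exp (-(δ₁ * g.dist y y'))

variable {g}

/-- The scale weight is non-negative. [folklore] -/
theorem ratio4_nonneg (y y' : g.Site) : 0 ≤ ratio4 g y y' := sq_nonneg _

/-- Bookkeeping: (L^jη)⁴/(L^{j′}η)⁴ = (L^{2j}/L^{2j′})² = `ratio4` (L, η ≠ 0). [folklore] -/
theorem ratio4_eq_len (hL : g.L ≠ 0) (hη : g.eta ≠ 0) (y y' : g.Site) :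
    ratio4 g y y' = g.len y ^ 4 / g.len y' ^ 4 := by
  have h := len_sq_eq hL hη y' y
  have hne : g.len y' ≠ 0 := by
    unfold B6.Geometry.len
    exact mul_ne_zero (pow_ne_zero _ hL) hη
  unfold ratio4
  rw [show g.len y ^ 4 = (g.len y ^ 2) ^ 2 by ring, h]
  field_simp

/-- The level exponent of (2.60) is symmetric in its two sites. [folklore] -/
theorem mx_symm (y y' : g.Site) : mx g y y' = mx g y' y := mx_comm y y'

/-- Member 3 ⇒ member 4, second use of the distance: if one support point y₀ ∈ supp h_{□′} at the scale of y′ realises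
D ≥ d(y, y₀), then (2.60) in its metric form gives RM·max{|j−j′|−1,0} ≤ D. [cite: Balaban1984PropagatorsII, (2.60) p.234] -/
theorem levelTerm_le (hsep : LevelSep g) {y y' y₀ : g.Site} {D : ℝ} (hsc : g.scale y₀ = g.scale y')
    (hD : g.dist y y₀ ≤ D) : g.R * g.M * mx g y y' ≤ D := by
  have hmx : mx g y y' = mx g y y₀ := by unfold mx; rw [hsc]
  rw [hmx]
  exact (hsep y y₀).trans hD

end Carriers

/-! ## §2. Member 2 ⇒ member 3: the single-scale sum over supp h_{□′} -/

section SingleScale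

variable {g : B6.Geometry}

/-- **MEMBER 2 ≤ c · MEMBER 3.**  Split the surplus ¼δ₀ of the rate of d(y, y″) as δ₁ + σδ₀ (≤ ¼δ₀): the kept ¼δ₀ is
bounded through D ≤ d(y, y″); δ₁d(y, y″) joins δ₁ρ(y″) ≥ δ₁d(y″, y′) to give δ₁d(y, y′) by (2.54); the residue σδ₀ is
summed over y″ ∈ supp h_{□′} ⊂ 𝔅 by (2.61) at α = σ with constant c.  (With the printed M-independent c₁(σ) this needs
σ > 0, i.e. δ₁ < ¼δ₀: see `line3_not_uniform_at_quarter`.) [cite: Balaban1984PropagatorsII, (2.83) p.237] -/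
theorem line2_le_line3 (htri : B6RandomWalk.Triangle254 g) (hd : ∀ a b : g.Site, 0 ≤ g.dist a b)
    {δ₀ δ₁ σ c D : ℝ} (hδ₀ : 0 ≤ δ₀) (hδ₁ : 0 ≤ δ₁) (hsplit : δ₁ + σ * δ₀ ≤ δ₀ / 4)
    (h261 : B6Lemma21Repaired.Ineq261With c g δ₀ σ) {S' : Finset g.Site} {ρ : g.Site → ℝ} {y y' : g.Site}
    (hρ : ∀ y'' ∈ S', g.dist y'' y' ≤ ρ y'') (hD : ∀ y'' ∈ S', D ≤ g.dist y y'') :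
    line283_2 g δ₀ δ₁ S' ρ y y' ≤ c * line283_3 g δ₀ δ₁ D y y' := by
  -- pointwise bound of the summand
  have hpt : ∀ y'' ∈ S', Real.exp (-(1 / 2 * δ₀ * g.dist y y'')) * Real.exp (-(δ₁ * ρ y'')) ≤
      Real.exp (-(1 / 4 * δ₀ * D)) * Real.exp (-(δ₁ * g.dist y y')) *
        Real.exp (-(σ * δ₀ * g.dist y y'')) := by
    intro y'' hy''
    rw [← Real.exp_add, ← Real.exp_add, ← Real.exp_add, Real.exp_le_exp]
    have h1 : δ₀ * D ≤ δ₀ * g.dist y y'' := mul_le_mul_of_nonneg_left (hD y'' hy'') hδ₀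
    have h2 : δ₁ * g.dist y'' y' ≤ δ₁ * ρ y'' := mul_le_mul_of_nonneg_left (hρ y'' hy'') hδ₁
    have h3 : δ₁ * g.dist y y' ≤ δ₁ * (g.dist y y'' + g.dist y'' y') :=
      mul_le_mul_of_nonneg_left (htri y y'' y') hδ₁
    have h4 : (δ₁ + σ * δ₀) * g.dist y y'' ≤ δ₀ / 4 * g.dist y y'' :=
      mul_le_mul_of_nonneg_right hsplit (hd y y'')
    linarith
  -- sum over the support, then (2.61) over all of 𝔅
  have hsum : ∑ y'' ∈ S', Real.exp (-(1 / 2 * δ₀ * g.dist y y'')) * Real.exp (-(δ₁ * ρ y'')) ≤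
      Real.exp (-(1 / 4 * δ₀ * D)) * Real.exp (-(δ₁ * g.dist y y')) * c := by
    calc ∑ y'' ∈ S', Real.exp (-(1 / 2 * δ₀ * g.dist y y'')) * Real.exp (-(δ₁ * ρ y''))
        ≤ ∑ y'' ∈ S', Real.exp (-(1 / 4 * δ₀ * D)) * Real.exp (-(δ₁ * g.dist y y')) *
            Real.exp (-(σ * δ₀ * g.dist y y'')) := Finset.sum_le_sum hpt
      _ = Real.exp (-(1 / 4 * δ₀ * D)) * Real.exp (-(δ₁ * g.dist y y')) *
            ∑ y'' ∈ S', Real.exp (-(σ * δ₀ * g.dist y y'')) := by rw [Finset.mul_sum]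
      _ ≤ Real.exp (-(1 / 4 * δ₀ * D)) * Real.exp (-(δ₁ * g.dist y y')) *
            ∑ y'' : g.Site, Real.exp (-(σ * δ₀ * g.dist y y'')) :=
          mul_le_mul_of_nonneg_left
            (Finset.sum_le_sum_of_subset_of_nonneg (Finset.subset_univ _) fun _ _ _ => (Real.exp_pos _).le)
            (by positivity)
      _ ≤ Real.exp (-(1 / 4 * δ₀ * D)) * Real.exp (-(δ₁ * g.dist y y')) * c :=
          mul_le_mul_of_nonneg_left (h261 y) (by positivity)
  unfold line283_2 line283_3
  calc ratio4 g y y' * ∑ y'' ∈ S', Real.exp (-(1 / 2 * δ₀ * g.dist y y'')) * Real.exp (-(δ₁ * ρ y''))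
      ≤ ratio4 g y y' * (Real.exp (-(1 / 4 * δ₀ * D)) * Real.exp (-(δ₁ * g.dist y y')) * c) :=
        mul_le_mul_of_nonneg_left hsum (ratio4_nonneg y y')
    _ = c * (ratio4 g y y' * Real.exp (-(1 / 4 * δ₀ * D)) * Real.exp (-(δ₁ * g.dist y y'))) := by ring

/-- The constant of (2.61) is non-negative (𝔅 is inhabited by y). [folklore] -/
theorem c_nonneg_of_ineq261With {δ₀ α c : ℝ} (h261 : B6Lemma21Repaired.Ineq261With c g δ₀ α) (y : g.Site) :
    0 ≤ c :=
  (h261 y).trans' (Finset.sum_nonneg fun _ _ => (Real.exp_pos _).le)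

end SingleScale

/-! ## §3. Member 3 ⇒ member 4 ⇒ member 5: the gap, the level separation, and the weight absorption -/

section ScaleWeight

variable {g : B6.Geometry}

/-- **MEMBER 3 ≤ MEMBER 4** (the printed «=» is a «≤»): ¼δ₀D = ⅛δ₀D + ⅛δ₀D ≥ ⅛δ₀Mg + ⅛δ₀RM·max{|j−j′|−1,0} from the gap
Mg ≤ D («y ∉ □̃′») and the level term ≤ D (`levelTerm_le`, (2.60)). [cite: Balaban1984PropagatorsII, (2.83) p.237] -/
theorem line3_le_line4 {δ₀ δ₁ D Mg : ℝ} (hδ₀ : 0 ≤ δ₀) {y y' : g.Site} (hgap : Mg ≤ D)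
    (hlev : g.R * g.M * mx g y y' ≤ D) :
    line283_3 g δ₀ δ₁ D y y' ≤ line283_4 g δ₀ δ₁ Mg y y' := by
  unfold line283_3 line283_4
  have hkey : Real.exp (-(1 / 4 * δ₀ * D)) ≤
      Real.exp (-(1 / 8 * δ₀ * Mg)) * Real.exp (-(1 / 8 * δ₀ * g.R * g.M * mx g y y')) := by
    rw [← Real.exp_add, Real.exp_le_exp]
    have h1 : δ₀ * Mg ≤ δ₀ * D := mul_le_mul_of_nonneg_left hgap hδ₀
    have h2 : δ₀ * (g.R * g.M * mx g y y') ≤ δ₀ * D := mul_le_mul_of_nonneg_left hlev hδ₀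
    linarith
  calc ratio4 g y y' * Real.exp (-(1 / 4 * δ₀ * D)) * Real.exp (-(δ₁ * g.dist y y'))
      ≤ ratio4 g y y' * (Real.exp (-(1 / 8 * δ₀ * Mg)) * Real.exp (-(1 / 8 * δ₀ * g.R * g.M * mx g y y'))) *
          Real.exp (-(δ₁ * g.dist y y')) := by
        have := ratio4_nonneg y y'
        gcongr
    _ = Real.exp (-(1 / 8 * δ₀ * Mg)) * ratio4 g y y' * Real.exp (-(1 / 8 * δ₀ * g.R * g.M * mx g y y')) *
          Real.exp (-(δ₁ * g.dist y y')) := by ring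

/-- THE WEIGHT ABSORPTION at the fourth power: if L ≥ 1, β ≥ 0 and L⁴ ≤ e^{β}, then
L^{4(j−j′)} e^{−β max{|j−j′|−1,0}} ≤ L⁴ for all levels j, j′ (the square of `B6Ineq268.ratio_mul_exp_le` at β/2).
[folklore] -/
theorem ratio4_mul_exp_le (hL : 1 ≤ g.L) {β : ℝ} (hβ : 0 ≤ β) (hthr : g.L ^ 4 ≤ Real.exp β) (y y' : g.Site) :
    ratio4 g y y' * Real.exp (-(β * mx g y y')) ≤ g.L ^ 4 := by
  have hL0 : 0 < g.L := lt_of_lt_of_le one_pos hL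
  have hsq : Real.exp (β / 2) ^ 2 = Real.exp β := by
    rw [← Real.exp_nat_mul]; congr 1; push_cast; ring
  have hthr2 : g.L ^ 2 ≤ Real.exp (β / 2) := by
    rw [← pow_le_pow_iff_left₀ (by positivity) (Real.exp_pos _).le two_ne_zero, hsq, ← pow_mul]
    simpa using hthr
  have h := ratio_mul_exp_le hL (by positivity : 0 ≤ β / 2) hthr2 y' y
  have h0 : 0 ≤ ratio g y' y * Real.exp (-(β / 2 * mx g y' y)) :=
    mul_nonneg (ratio_nonneg hL0.le _ _) (Real.exp_pos _).le
  have hsq2 : ratio4 g y y' * Real.exp (-(β * mx g y y')) =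
      (ratio g y' y * Real.exp (-(β / 2 * mx g y' y))) ^ 2 := by
    unfold ratio4
    rw [mul_pow, ← Real.exp_nat_mul, mx_symm y' y]
    congr 2
    push_cast; ring
  rw [hsq2]
  calc (ratio g y' y * Real.exp (-(β / 2 * mx g y' y))) ^ 2 ≤ (g.L ^ 2) ^ 2 := pow_le_pow_left₀ h0 h 2
    _ = g.L ^ 4 := by ring

/-- **MEMBER 4 ≤ MEMBER 5, uniformly in the number of scales**, as soon as L⁴ ≤ e^{⅛δ₀RM} (32 log L ≤ δ₀RM).
[cite: Balaban1984PropagatorsII, (2.83) p.237] -/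
theorem line4_le_line5 (hL : 1 ≤ g.L) {δ₀ δ₁ Mg : ℝ} (hδRM : 0 ≤ δ₀ * (g.R * g.M))
    (hthr : g.L ^ 4 ≤ Real.exp (1 / 8 * δ₀ * g.R * g.M)) (y y' : g.Site) :
    line283_4 g δ₀ δ₁ Mg y y' ≤ line283_5 g δ₀ δ₁ Mg y y' := by
  unfold line283_4 line283_5
  have hβ : 0 ≤ 1 / 8 * δ₀ * g.R * g.M := by linarith [hδRM]
  have h := ratio4_mul_exp_le hL hβ hthr y y'
  calc Real.exp (-(1 / 8 * δ₀ * Mg)) * ratio4 g y y' * Real.exp (-(1 / 8 * δ₀ * g.R * g.M * mx g y y')) *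
        Real.exp (-(δ₁ * g.dist y y'))
      = ratio4 g y y' * Real.exp (-(1 / 8 * δ₀ * g.R * g.M * mx g y y')) * Real.exp (-(1 / 8 * δ₀ * Mg)) *
          Real.exp (-(δ₁ * g.dist y y')) := by ring
    _ ≤ g.L ^ 4 * Real.exp (-(1 / 8 * δ₀ * Mg)) * Real.exp (-(δ₁ * g.dist y y')) := by gcongr

/-- **THE WHOLE CHAIN, MEMBER 2 ≤ c · MEMBER 5**, under: (2.54), non-negative distance, (2.60) in metric form, (2.61)
at α = σ with δ₁ + σδ₀ ≤ ¼δ₀, the straight-contour comparison on supp h_{□′}, D = d(y, supp h_{□′}) realised by a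
support point y₀ at the scale of y′, the gap Mg ≤ D, and 32 log L ≤ δ₀RM. [cite: Balaban1984PropagatorsII, (2.83) p.237] -/
theorem line2_le_line5 (htri : B6RandomWalk.Triangle254 g) (hd : ∀ a b : g.Site, 0 ≤ g.dist a b)
    (hsep : LevelSep g) (hL : 1 ≤ g.L) {δ₀ δ₁ σ c D Mg : ℝ} (hδ₀ : 0 ≤ δ₀) (hδ₁ : 0 ≤ δ₁)
    (hsplit : δ₁ + σ * δ₀ ≤ δ₀ / 4) (h261 : B6Lemma21Repaired.Ineq261With c g δ₀ σ) (hRM : 0 ≤ g.R * g.M)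
    (hthr : g.L ^ 4 ≤ Real.exp (1 / 8 * δ₀ * g.R * g.M)) {S' : Finset g.Site} {ρ : g.Site → ℝ}
    {y y' y₀ : g.Site} (hρ : ∀ y'' ∈ S', g.dist y'' y' ≤ ρ y'') (hD : ∀ y'' ∈ S', D ≤ g.dist y y'')
    (hsc : g.scale y₀ = g.scale y') (hy₀ : g.dist y y₀ ≤ D) (hgap : Mg ≤ D) :
    line283_2 g δ₀ δ₁ S' ρ y y' ≤ c * line283_5 g δ₀ δ₁ Mg y y' := by
  have hc : 0 ≤ c := c_nonneg_of_ineq261With h261 y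
  refine (line2_le_line3 htri hd hδ₀ hδ₁ hsplit h261 hρ hD).trans (mul_le_mul_of_nonneg_left ?_ hc)
  exact (line3_le_line4 hδ₀ hgap (levelTerm_le hsep hsc hy₀)).trans
    (line4_le_line5 hL (mul_nonneg hδ₀ hRM) hthr y y')

end ScaleWeight

/-! ## §4. The threshold 32 log L ≤ δ₀RM is sharp (chain witness of `…B6Ineq268`) -/

section Threshold

/-- Member 4 = member 5 / L⁴ × (the absorbed quantity L^{4(j−j′)} e^{−⅛δ₀RM max{|j−j′|−1,0}}) (L ≠ 0). [folklore] -/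
theorem line4_eq_line5_mul {g : B6.Geometry} (hL : g.L ≠ 0) (δ₀ δ₁ Mg : ℝ) (y y' : g.Site) :
    line283_4 g δ₀ δ₁ Mg y y' = line283_5 g δ₀ δ₁ Mg y y' / g.L ^ 4 *
      (ratio4 g y y' * Real.exp (-(1 / 8 * δ₀ * g.R * g.M * mx g y y'))) := by
  unfold line283_4 line283_5
  have h4 : g.L ^ 4 ≠ 0 := pow_ne_zero _ hL
  field_simp

variable {L R M : ℝ}

/-- **THE THRESHOLD IS SHARP.**  If e^{⅛δ₀RM} < L⁴ (32 log L > δ₀RM) then, on the chain witness of depth N (one site per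
level, consecutive levels RM apart; it satisfies (2.54), symmetry, (2.60) and (2.61) with k-independent constants —
`B6Ineq268.chainGeo_triangle/…_symm/…_levelSep/…_ineq261With`), member 4 at y = top level, y′ = bottom level is
(L⁴e^{−⅛δ₀RM})^{N−1} times member 5: for every C some depth violates member 4 ≤ C · member 5. [folklore] -/
theorem line4_not_uniform {δ₀ δ₁ Mg : ℝ} (hL : 1 ≤ L) (hthr : Real.exp (1 / 8 * δ₀ * R * M) < L ^ 4) (C : ℝ) :
    ∃ N : ℕ, C * line283_5 (chainGeo N L R M) δ₀ δ₁ Mg (Fin.last N) 0 <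
      line283_4 (chainGeo N L R M) δ₀ δ₁ Mg (Fin.last N) 0 := by
  have hL0 : 0 < L := lt_of_lt_of_le one_pos hL
  have hL4 : L ^ 4 ≠ 0 := pow_ne_zero _ hL0.ne'
  -- the ratio r = L⁴ e^{−⅛δ₀RM} > 1
  set r : ℝ := L ^ 4 * Real.exp (-(1 / 8 * δ₀ * R * M)) with hr
  have hr1 : 1 < r := by
    rw [hr, Real.exp_neg, ← div_eq_mul_inv, one_lt_div (Real.exp_pos _)]
    exact hthr
  obtain ⟨n, hn⟩ := pow_unbounded_of_one_lt C hr1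
  refine ⟨n + 1, ?_⟩
  -- the ingredients on the witness of depth n + 1 at (top, bottom)
  have hmx : mx (chainGeo (n + 1) L R M) (Fin.last (n + 1)) 0 = n :=
    mx_eq_of_lt' (g := chainGeo (n + 1) L R M) (by simp only [Fin.val_last, Fin.val_zero]; omega)
  have hratio : ratio4 (chainGeo (n + 1) L R M) (Fin.last (n + 1)) 0 = L ^ 4 * (L ^ 4) ^ n := by
    simp only [ratio4, ratio, Fin.val_last, Fin.val_zero, mul_zero, pow_zero, div_one]
    ring
  have hkey : ratio4 (chainGeo (n + 1) L R M) (Fin.last (n + 1)) 0 *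
      Real.exp (-(1 / 8 * δ₀ * (chainGeo (n + 1) L R M).R * (chainGeo (n + 1) L R M).M *
        mx (chainGeo (n + 1) L R M) (Fin.last (n + 1)) 0)) = L ^ 4 * r ^ n := by
    rw [hmx, hratio, chainGeo_R, chainGeo_M, hr, mul_pow, ← Real.exp_nat_mul,
      show ((n : ℕ) : ℝ) * -(1 / 8 * δ₀ * R * M) = -(1 / 8 * δ₀ * R * M * (n : ℝ)) by ring]
    ring
  have hLg : (chainGeo (n + 1) L R M).L ≠ 0 := by rw [chainGeo_L]; exact hL0.ne'
  have h5pos : 0 < line283_5 (chainGeo (n + 1) L R M) δ₀ δ₁ Mg (Fin.last (n + 1)) 0 := by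
    unfold line283_5
    exact mul_pos (mul_pos (pow_pos hL0 4) (Real.exp_pos _)) (Real.exp_pos _)
  rw [line4_eq_line5_mul hLg, hkey, chainGeo_L]
  have hre : line283_5 (chainGeo (n + 1) L R M) δ₀ δ₁ Mg (Fin.last (n + 1)) 0 / L ^ 4 * (L ^ 4 * r ^ n)
      = r ^ n * line283_5 (chainGeo (n + 1) L R M) δ₀ δ₁ Mg (Fin.last (n + 1)) 0 := by
    field_simp
  rw [hre]
  exact mul_lt_mul_of_pos_right hn h5pos

end Threshold

/-! ## §5. The rate condition δ₁ < ¼δ₀ is sharp for an M-uniform O(1) (the «face» witness) -/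

section Face

/-- The points of the face witness in (ℝ², ℓ^∞): the support points p_t = (0, t), t = 0, …, m (a face of supp h_{□′}
seen from y), y = (−D, 0), y′ = (m, m). [folklore] -/
def facePt (m : ℕ) (D : ℝ) : Fin (m + 1) ⊕ Bool → ℝ × ℝ
  | .inl t => (0, ((t : ℕ) : ℝ))
  | .inr false => (-D, 0)
  | .inr true => ((m : ℝ), (m : ℝ))

/-- THE FACE WITNESS: 𝔅 = {p₀, …, p_m} ∪ {y, y′}, one scale, d = the ℓ^∞ distance of the points `facePt` (so
d(p_t, p_s) = |t − s|, d(y, p_t) = D, d(p_t, y′) = m, d(y, y′) = D + m when m ≤ D); the parameters L, R, M and the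
localisation vocabulary of `B6.Geometry` are irrelevant and filled trivially. [folklore] -/
@[reducible] noncomputable def faceGeo (m : ℕ) (D L R M : ℝ) : B6.Geometry where
  Site := Fin (m + 1) ⊕ Bool
  fin := inferInstance
  scale := fun _ => 0
  dist := fun a b => dist (facePt m D a) (facePt m D b)
  k := 0
  eta := 1
  L := L
  R := R
  M := M
  Hyp21_22 := True
  Loc := PUnit
  suppIn := fun _ _ => True
  supNorm := fun _ => 0
  l2Norm := fun _ => 0
  holder := fun _ _ => 0
  Cut := PUnit
  cutIn := fun _ _ => True
  cutH := fun _ _ => 0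
  cutSup := fun _ => 0

variable {m : ℕ} {D L R M : ℝ}

/-- The witness distance, by definition. [folklore] -/
theorem faceGeo_dist (a b : Fin (m + 1) ⊕ Bool) :
    (faceGeo m D L R M).dist a b = dist (facePt m D a) (facePt m D b) := rfl

/-- A support index is ≤ m as a real number. [folklore] -/
theorem fin_le (t : Fin (m + 1)) : ((t : ℕ) : ℝ) ≤ m := by
  exact_mod_cast Nat.lt_succ_iff.mp t.is_lt

/-- d(p_t, p_s) = |t − s|. [folklore] -/
theorem facePt_dist_p_p (t s : Fin (m + 1)) :
    dist (facePt m D (Sum.inl t)) (facePt m D (Sum.inl s)) = |((t : ℕ) : ℝ) - ((s : ℕ) : ℝ)| := by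
  simp only [facePt, Prod.dist_eq, Real.dist_eq, sub_self, abs_zero]
  exact max_eq_right (abs_nonneg _)

/-- d(y, p_t) = D (t ≤ m ≤ D). [folklore] -/
theorem facePt_dist_y_p (hmD : (m : ℝ) ≤ D) (t : Fin (m + 1)) :
    dist (facePt m D (Sum.inr false)) (facePt m D (Sum.inl t)) = D := by
  have ht := fin_le t
  have ht0 : (0 : ℝ) ≤ ((t : ℕ) : ℝ) := Nat.cast_nonneg _
  have hm0 : (0 : ℝ) ≤ (m : ℝ) := Nat.cast_nonneg _
  simp only [facePt, Prod.dist_eq, Real.dist_eq, sub_zero, abs_neg, zero_sub]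
  rw [abs_of_nonneg (by linarith), abs_of_nonneg ht0]
  exact max_eq_left (by linarith)

/-- d(p_t, y′) = m. [folklore] -/
theorem facePt_dist_p_y' (t : Fin (m + 1)) :
    dist (facePt m D (Sum.inl t)) (facePt m D (Sum.inr true)) = m := by
  have ht := fin_le t
  have ht0 : (0 : ℝ) ≤ ((t : ℕ) : ℝ) := Nat.cast_nonneg _
  simp only [facePt, Prod.dist_eq, Real.dist_eq, zero_sub, abs_neg]
  rw [abs_of_nonneg (Nat.cast_nonneg m), abs_sub_comm, abs_of_nonneg (by linarith)]
  exact max_eq_left (by linarith)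

/-- d(y′, p_t) = m. [folklore] -/
theorem facePt_dist_y'_p (t : Fin (m + 1)) :
    dist (facePt m D (Sum.inr true)) (facePt m D (Sum.inl t)) = m := by
  rw [dist_comm]
  exact facePt_dist_p_y' t

/-- d(y, y′) = D + m (0 ≤ D). [folklore] -/
theorem facePt_dist_y_y' (hD : 0 ≤ D) :
    dist (facePt m D (Sum.inr false)) (facePt m D (Sum.inr true)) = D + m := by
  have hm0 : (0 : ℝ) ≤ (m : ℝ) := Nat.cast_nonneg _
  simp only [facePt, Prod.dist_eq, Real.dist_eq, zero_sub, abs_neg]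
  rw [abs_of_nonneg hm0, show -D - (m : ℝ) = -(D + m) by ring, abs_neg, abs_of_nonneg (by positivity)]
  exact max_eq_left (by linarith)

/-- The face witness satisfies the triangle inequality (2.54) (inherited from ℝ²). [folklore] -/
theorem faceGeo_triangle : B6RandomWalk.Triangle254 (faceGeo m D L R M) :=
  fun a b c => dist_triangle (facePt m D a) (facePt m D b) (facePt m D c)

/-- The face witness has a symmetric distance. [folklore] -/
theorem faceGeo_symm : Symm (faceGeo m D L R M) :=
  fun a b => dist_comm (facePt m D a) (facePt m D b)

/-- The face witness has a non-negative distance. [folklore] -/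
theorem faceGeo_dist_nonneg (a b : Fin (m + 1) ⊕ Bool) : 0 ≤ (faceGeo m D L R M).dist a b := dist_nonneg

/-- The face witness has one scale, so the level exponent vanishes … [folklore] -/
theorem faceGeo_mx (a b : Fin (m + 1) ⊕ Bool) : mx (faceGeo m D L R M) a b = 0 := by
  unfold mx
  have h0 : ((faceGeo m D L R M).scale a : ℝ) - (faceGeo m D L R M).scale b = 0 := by
    show ((0 : ℕ) : ℝ) - ((0 : ℕ) : ℝ) = 0
    simp
  rw [h0, abs_zero]
  exact max_eq_right (by norm_num)

/-- … and (2.60) in metric form holds trivially. [folklore] -/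
theorem faceGeo_levelSep : LevelSep (faceGeo m D L R M) := by
  intro a b
  rw [faceGeo_mx, mul_zero]
  exact faceGeo_dist_nonneg a b

/-- The support block of any row of (2.61) on the face witness is ≤ c₀(α) = Σ_{z∈ℤ} e^{−αδ₀|z|} (m ≤ D): from p_s the
distances to p_t are |s − t|; from y resp. y′ they are D ≥ t resp. m ≥ t. [folklore] -/
theorem faceGeo_sum_inl_le {δ₀ α : ℝ} (h : 0 < α * δ₀) (hmD : (m : ℝ) ≤ D) (a : Fin (m + 1) ⊕ Bool) :
    ∑ t : Fin (m + 1), Real.exp (-(α * δ₀ * (faceGeo m D L R M).dist a (Sum.inl t))) ≤ B6.c0 δ₀ α := by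
  unfold B6.c0
  set f : ℤ → ℝ := fun z => Real.exp (-(α * δ₀ * |(z : ℝ)|)) with hf
  have hsum : Summable f := B6Lemma21Arith.summable_c0_term h
  -- an injective relabelling φ with termwise domination by f ∘ φ
  have key : ∀ (φ : Fin (m + 1) → ℤ), Function.Injective φ →
      (∀ t, Real.exp (-(α * δ₀ * (faceGeo m D L R M).dist a (Sum.inl t))) ≤ f (φ t)) →
      ∑ t : Fin (m + 1), Real.exp (-(α * δ₀ * (faceGeo m D L R M).dist a (Sum.inl t))) ≤ ∑' z, f z := by
    intro φ hinj hdom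
    calc ∑ t, Real.exp (-(α * δ₀ * (faceGeo m D L R M).dist a (Sum.inl t)))
        ≤ ∑ t, f (φ t) := Finset.sum_le_sum fun t _ => hdom t
      _ = ∑ z ∈ Finset.univ.image φ, f z := (Finset.sum_image fun a _ b _ hab => hinj hab).symm
      _ ≤ ∑' z, f z := hsum.sum_le_tsum _ fun z _ => (Real.exp_pos _).le
  rcases a with s | b
  · -- a = p_s : distances |s − t| = |φ t| with φ t = t − s
    refine key (fun t => ((t : ℕ) : ℤ) - ((s : ℕ) : ℤ))
      (fun a b (hab : ((a : ℕ) : ℤ) - ((s : ℕ) : ℤ) = ((b : ℕ) : ℤ) - ((s : ℕ) : ℤ)) =>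
        Fin.ext (Nat.cast_inj.mp (sub_left_inj.mp hab))) ?_
    intro t
    apply le_of_eq
    rw [faceGeo_dist, facePt_dist_p_p]
    simp only [hf]
    push_cast
    rw [abs_sub_comm]
  · -- a = y or y′ : constant distance D ≥ t resp. m ≥ t, dominated with φ t = t
    refine key (fun t => ((t : ℕ) : ℤ))
      (fun a b (hab : ((a : ℕ) : ℤ) = ((b : ℕ) : ℤ)) => Fin.ext (Nat.cast_inj.mp hab)) ?_
    intro t
    have ht := fin_le t
    have ht0 : (0 : ℝ) ≤ ((t : ℕ) : ℝ) := Nat.cast_nonneg _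
    have hdist : ((t : ℕ) : ℝ) ≤ (faceGeo m D L R M).dist (Sum.inr b) (Sum.inl t) := by
      cases b
      · rw [faceGeo_dist, facePt_dist_y_p hmD t]
        exact ht.trans hmD
      · rw [faceGeo_dist, facePt_dist_y'_p t]
        exact ht
    have hexp : Real.exp (-(α * δ₀ * (faceGeo m D L R M).dist (Sum.inr b) (Sum.inl t))) ≤
        Real.exp (-(α * δ₀ * ((t : ℕ) : ℝ))) := by
      rw [Real.exp_le_exp]
      nlinarith [hdist, h]
    simp only [hf, Int.cast_natCast]
    rw [abs_of_nonneg ht0]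
    exact hexp

/-- The face witness satisfies (2.61) at every rate α (αδ₀ > 0) with the m- and D-independent constant 2 + c₀(α)
(m ≤ D). [folklore] -/
theorem faceGeo_ineq261With {δ₀ α : ℝ} (h : 0 < α * δ₀) (hmD : (m : ℝ) ≤ D) :
    B6Lemma21Repaired.Ineq261With (2 + B6.c0 δ₀ α) (faceGeo m D L R M) δ₀ α := by
  intro a
  rw [Fintype.sum_sum_type, Fintype.sum_bool]
  have h1 := faceGeo_sum_inl_le (L := L) (R := R) (M := M) h hmD a
  have hle1 : ∀ b : Bool, Real.exp (-(α * δ₀ * (faceGeo m D L R M).dist a (Sum.inr b))) ≤ 1 := by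
    intro b
    rw [Real.exp_le_one_iff, neg_nonpos]
    exact mul_nonneg h.le (faceGeo_dist_nonneg a _)
  have h2 := hle1 true
  have h3 := hle1 false
  linarith

/-- The data of the violating configuration: S′ = {p₀, …, p_m}, ρ = d(·, y′) (so the straight-contour hypothesis holds
with equality), y = `inr false`, y′ = `inr true`. [folklore] -/
def faceSupp (m : ℕ) : Finset (Fin (m + 1) ⊕ Bool) := Finset.univ.map ⟨Sum.inl, Sum.inl_injective⟩

/-- The scale weight on the one-scale face witness is 1. [folklore] -/
theorem face_ratio4 (a b : Fin (m + 1) ⊕ Bool) : ratio4 (faceGeo m D L R M) a b = 1 := by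
  unfold ratio4 ratio
  simp

/-- Member 2 on the face witness: (m + 1) e^{−½δ₀D} e^{−δ₁m}. [folklore] -/
theorem face_line2 (hmD : (m : ℝ) ≤ D) (δ₀ δ₁ : ℝ) :
    line283_2 (faceGeo m D L R M) δ₀ δ₁ (faceSupp m)
        (fun b => (faceGeo m D L R M).dist b (Sum.inr true)) (Sum.inr false) (Sum.inr true)
      = (m + 1) * (Real.exp (-(1 / 2 * δ₀ * D)) * Real.exp (-(δ₁ * m))) := by
  have hterm : ∀ t : Fin (m + 1),
      Real.exp (-(1 / 2 * δ₀ * (faceGeo m D L R M).dist (Sum.inr false) (Sum.inl t))) *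
        Real.exp (-(δ₁ * (faceGeo m D L R M).dist (Sum.inl t) (Sum.inr true)))
      = Real.exp (-(1 / 2 * δ₀ * D)) * Real.exp (-(δ₁ * m)) := by
    intro t
    rw [faceGeo_dist, faceGeo_dist, facePt_dist_y_p hmD, facePt_dist_p_y']
  unfold line283_2 faceSupp
  rw [face_ratio4, one_mul, Finset.sum_map]
  calc ∑ t : Fin (m + 1), Real.exp (-(1 / 2 * δ₀ * (faceGeo m D L R M).dist (Sum.inr false)
          ((⟨Sum.inl, Sum.inl_injective⟩ : Fin (m + 1) ↪ Fin (m + 1) ⊕ Bool) t))) *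
          Real.exp (-(δ₁ * (fun b => (faceGeo m D L R M).dist b (Sum.inr true))
            ((⟨Sum.inl, Sum.inl_injective⟩ : Fin (m + 1) ↪ Fin (m + 1) ⊕ Bool) t)))
      = ∑ t : Fin (m + 1), Real.exp (-(1 / 2 * δ₀ * D)) * Real.exp (-(δ₁ * m)) :=
        Finset.sum_congr rfl fun t _ => hterm t
    _ = (m + 1) * (Real.exp (-(1 / 2 * δ₀ * D)) * Real.exp (-(δ₁ * m))) := by
        rw [Finset.sum_const, Finset.card_univ, Fintype.card_fin, nsmul_eq_mul]
        push_cast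
        ring

/-- Member 3 on the face witness with D = d(y, supp h_{□′}): e^{−¼δ₀D} e^{−δ₁(D+m)}. [folklore] -/
theorem face_line3 (hD : 0 ≤ D) (δ₀ δ₁ : ℝ) :
    line283_3 (faceGeo m D L R M) δ₀ δ₁ D (Sum.inr false) (Sum.inr true)
      = Real.exp (-(1 / 4 * δ₀ * D)) * Real.exp (-(δ₁ * (D + m))) := by
  unfold line283_3
  rw [face_ratio4, one_mul, faceGeo_dist, facePt_dist_y_y' hD]

/-- The hypotheses of `line2_le_line3` hold on the face configuration: the straight-contour comparison (with
equality) and D ≤ d(y, y″) on the support. [folklore] -/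
theorem face_hyps (hmD : (m : ℝ) ≤ D) :
    (∀ y'' ∈ faceSupp m, (faceGeo m D L R M).dist y'' (Sum.inr true) ≤
        (fun b => (faceGeo m D L R M).dist b (Sum.inr true)) y'') ∧
      (∀ y'' ∈ faceSupp m, D ≤ (faceGeo m D L R M).dist (Sum.inr false) y'') := by
  refine ⟨fun y'' _ => le_rfl, fun y'' hy'' => ?_⟩
  unfold faceSupp at hy''
  rw [Finset.mem_map] at hy''
  obtain ⟨t, _, rfl⟩ := hy''
  exact (facePt_dist_y_p hmD t).ge

/-- **ABOVE THE QUARTER THE SHAPE OF MEMBER 3 FAILS**: if δ₁ > ¼δ₀ then for every C there is a face configuration with a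
ONE-POINT support (m = 0) at which member 2 > C · member 3 — the summand decays like e^{−½δ₀D} while member 3 asks
for e^{−(¼δ₀+δ₁)D}. [folklore] -/
theorem line3_not_uniform_above_quarter {δ₀ δ₁ : ℝ} (hq : δ₀ / 4 < δ₁) (C : ℝ) :
    ∃ D : ℝ, 0 ≤ D ∧
      C * line283_3 (faceGeo 0 D L R M) δ₀ δ₁ D (Sum.inr false) (Sum.inr true) <
        line283_2 (faceGeo 0 D L R M) δ₀ δ₁ (faceSupp 0)
          (fun b => (faceGeo 0 D L R M).dist b (Sum.inr true)) (Sum.inr false) (Sum.inr true) := by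
  -- choose D ≥ 0 with (δ₁ − ¼δ₀)·D ≥ C, so that e^{(δ₁−¼δ₀)D} ≥ (δ₁−¼δ₀)D + 1 > C
  set κ : ℝ := δ₁ - δ₀ / 4 with hκ
  have hκ0 : 0 < κ := by rw [hκ]; linarith
  refine ⟨max 0 (C / κ), le_max_left _ _, ?_⟩
  set D : ℝ := max 0 (C / κ) with hDdef
  have hD0 : 0 ≤ D := le_max_left _ _
  have hCD : C ≤ κ * D := by
    have h1 : C / κ ≤ D := le_max_right _ _
    have h2 : C / κ * κ ≤ D * κ := mul_le_mul_of_nonneg_right h1 hκ0.le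
    rw [div_mul_cancel₀ C hκ0.ne'] at h2
    linarith
  rw [face_line2 (by simpa using hD0), face_line3 hD0]
  push_cast
  simp only [zero_add, one_mul, mul_zero, add_zero, neg_zero, Real.exp_zero, mul_one]
  -- goal: C * (e^{−¼δ₀D} e^{−δ₁D}) < e^{−½δ₀D}
  have hexp : Real.exp (-(1 / 4 * δ₀ * D)) * Real.exp (-(δ₁ * D)) =
      Real.exp (-(1 / 2 * δ₀ * D)) * Real.exp (-(κ * D)) := by
    rw [← Real.exp_add, ← Real.exp_add, hκ]
    congr 1; ring
  rw [hexp]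
  have hgrow : C < Real.exp (κ * D) :=
    lt_of_le_of_lt hCD (by linarith [Real.add_one_le_exp (κ * D)])
  have hpos : 0 < Real.exp (-(1 / 2 * δ₀ * D)) := Real.exp_pos _
  have hinv : Real.exp (-(κ * D)) * Real.exp (κ * D) = 1 := by
    rw [← Real.exp_add]; simp
  calc C * (Real.exp (-(1 / 2 * δ₀ * D)) * Real.exp (-(κ * D)))
      = (C * Real.exp (-(κ * D))) * Real.exp (-(1 / 2 * δ₀ * D)) := by ring
    _ < 1 * Real.exp (-(1 / 2 * δ₀ * D)) := by
        refine mul_lt_mul_of_pos_right ?_ hpos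
        calc C * Real.exp (-(κ * D)) < Real.exp (κ * D) * Real.exp (-(κ * D)) :=
              mul_lt_mul_of_pos_right hgrow (Real.exp_pos _)
          _ = 1 := by rw [mul_comm, hinv]
    _ = Real.exp (-(1 / 2 * δ₀ * D)) := one_mul _

/-- **AT THE QUARTER THE CONSTANT GROWS WITH THE SUPPORT**: if δ₁ = ¼δ₀ then for every C there is a face configuration
(m + 1 support points, D = m) at which member 2 > C · member 3 — member 2 / member 3 = m + 1 exactly.  Since every
face witness satisfies (2.54), symmetry, (2.60) and (2.61) with constants independent of m (`faceGeo_triangle`,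
`faceGeo_symm`, `faceGeo_levelSep`, `faceGeo_ineq261With`), no O(1) depending only on those constants exists in
member 3 at δ₁ = ¼δ₀: the M-uniform O(1) of (2.83) needs δ₁ < ¼δ₀. [folklore] -/
theorem line3_not_uniform_at_quarter {δ₀ : ℝ} (C : ℝ) :
    ∃ m : ℕ,
      C * line283_3 (faceGeo m (m : ℝ) L R M) δ₀ (δ₀ / 4) (m : ℝ) (Sum.inr false) (Sum.inr true) <
        line283_2 (faceGeo m (m : ℝ) L R M) δ₀ (δ₀ / 4) (faceSupp m)
          (fun b => (faceGeo m (m : ℝ) L R M).dist b (Sum.inr true)) (Sum.inr false) (Sum.inr true) := by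
  obtain ⟨m, hm⟩ := exists_nat_gt C
  refine ⟨m, ?_⟩
  rw [face_line2 le_rfl, face_line3 (Nat.cast_nonneg m)]
  -- both exponential products equal e^{−¾δ₀m}
  have hexp : Real.exp (-(1 / 4 * δ₀ * (m : ℝ))) * Real.exp (-(δ₀ / 4 * ((m : ℝ) + m))) =
      Real.exp (-(1 / 2 * δ₀ * (m : ℝ))) * Real.exp (-(δ₀ / 4 * (m : ℝ))) := by
    rw [← Real.exp_add, ← Real.exp_add]
    congr 1; ring
  rw [hexp]
  have hpos : 0 < Real.exp (-(1 / 2 * δ₀ * (m : ℝ))) * Real.exp (-(δ₀ / 4 * (m : ℝ))) :=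
    mul_pos (Real.exp_pos _) (Real.exp_pos _)
  exact mul_lt_mul_of_pos_right (by linarith) hpos

end Face

end Literature.MathematicalPhysics.QuantumFieldTheory.Balaban1983to89.B6Ineq283
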